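import Summits.ABC.IUTFork.Cor312VolumesArchSummands
import Summits.ABC.IUTFork.Cor312VolumesRealAssembly
import HarnessLib

/-!
# [IUTchIII] Corollary 3.12, statement — the verbatim container of the REAL log-shells with an HONEST
# ARCHIMEDEAN TERM: the archimedean presentation of `Real.logShellsDH` under [IUTchI] Def. 3.1 (a) "`√−1 ∈ F`"

Record-only file (D-0012) of the abc-iut cell (wave-5 prover seat abc-iut-w5-d163 gen 2; TEAM A row A-0 NAMED
LEFTOVER (4) «archimedean radial container (print-level) vs DH convention»); TAKES NO SIDE on [IUTchIII] Cor. 3.12.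
abc-iut-c312-5's `Cor312VolumesRealAssembly` assembles the verbatim mono-analytic container of [IUTchIII]
Rmk. 3.1.1 (ii)(iii) for the real Dupuy–Hilado-level log-shells `Real.logShellsDH X logv` with the TRIVIAL
one-point container at `v_ℚ = ∞` (flagged modelling choice: log-volume `0`, no archimedean term). THIS file
replaces that component by the HONEST archimedean local pieces of `Cor312VolumesArchSummands` — the real
archimedean packet `M_I = ⊗_{i∈S^±_{j+1},ℝ} (⊕_{v|∞} ℂ_v)` of [IUTchIV] Prop. 1.5 (iii) (abc-iut-L5-t7) with
its normalised packet log-volume ([IUTchIII] Prop. 3.9 (i), archimedean case; [IUTchIV] Step (vii)) — under the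
printed hypothesis [IUTchI] Def. 3.1 (a) "`F` is a number field such that `√−1 ∈ F`" (so every archimedean `K_v`
is COMPLEX; abc-iut-L5-t2's `InitialThetaData.sqrt_neg_one_mem` supplies it for genuine initial Θ-data;
`isComplex_of_sqrt_neg_one`):

* `Real.archPresentationDH X logv hc : ArchPresentation (logShellsDH X logv) (.inl ())` — `K_v ≃ ℂ` by Mathlib's
  `InfinitePlace.Completion.ringEquivComplexOfIsComplex` (an isometry: `extensionEmbedding`), under which
  c312-5's shell `I_v = {|a| ≤ π}` (`shell_inl`, [IUTchIII] Rmk. 1.2.2 (ii)) IS the closed ball of radius `π`,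
  the strip slot `stripAutDH = {1}` and the archimedean Ism slot `ismDH (.inl w) = {1, −1}` ([IUTchIII]
  Thm. 3.11 (i) (Ind2) p. 154 "copies of each of the automorphisms of order 2") act by the real linear isometries
  `1`, `−1` of `ℂ`;
* `Real.localPiecesDHArch` / `Real.summandPiecesDHArch` — c312-5's `localPiecesDH` with the `∞`-component
  REPLACED by these pieces (NEW definitions; the landed `summandPiecesDH` is untouched), and
  **`generatorsPreserve_summandPiecesDHArch`** (no hypothesis beyond analyticity of `logv` and `√−1 ∈ F`);
* the A-0 consequences re-instantiated verbatim for `Real.situationDHVolArch` (c312-5's `Situation.ofShells`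
  carrying THIS container): `adm_and_logvol_eq_of_mem_indGroup_DHArch` ((Ind1)/(Ind2) invariance of
  admissibility and log-volume along the whole indeterminacy subgroup — B's `MRData.LogvolInvariant` — now WITH
  the archimedean place honest), `adm_and_logvol_possibleImage_eq_DHArch`, `bridgeHyps_DHArch` (c312-6's
  `BridgeHyps` with `mono`/`image_adm`/`image_fin`/`theta_nonempty` DISCHARGED; the SAME named residuals
  `hθ`/`hfin`/`hul_nonempty`/`ThetaFinite` as c312-5's `bridgeHyps_DH`).
[claim: Mochizuki2012, status: disputed] for the quoted container; classical elsewhere. Deliberately NOT here: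
the `Cor312.Setting` term over `situationDHVolArch` (c312-5/c312-7 `Setting.ofComparison` lineage), Θ-boxes,
the archimedean Θ-region itself ([IUTchIV] Step (vii) container `π^{j+1}·B_I` of log-volume `(j+1)·log π`:
`ArchPresentation.logμ_pi_pow_smul_ball`), any judgement. typed ≠ discharged; instantiated ≠ endorsed.
-/

noncomputable section

open Set Function NumberField IsDedekindDomain

namespace Summit.ABC

namespace IUTFork

namespace Thm311

namespace Real

open Cor312 Cor312Vol Literature.IUT.LogThetaLattice Literature.IUT.LogVolume

variable {F : Type} [Field F] [NumberField F] (X : PilotData F) (logv : PadicLogs F)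

/-! ## 1. `√−1 ∈ F` ⇒ every archimedean place is complex ([IUTchI] Def. 3.1 (a)) -/

omit [NumberField F] in
/-- **[IUTchI] Def. 3.1 (a) "`F` is a number field such that `√−1 ∈ F`" makes every archimedean place of `F`
COMPLEX** (a real embedding would send `√−1` to a real square root of `−1`). [folklore] -/
theorem isComplex_of_sqrt_neg_one (h : ∃ i : F, i ^ 2 = -1) (w : InfinitePlace F) : w.IsComplex := by
  rw [← InfinitePlace.not_isReal_iff_isComplex]
  intro hw
  obtain ⟨i, hi⟩ := h
  have h1 : ((InfinitePlace.embedding_of_isReal hw i : ℝ) : ℂ) ^ 2 = -1 := by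
    rw [InfinitePlace.embedding_of_isReal_apply, ← map_pow, hi, map_neg, map_one]
  have h2 : (InfinitePlace.embedding_of_isReal hw i : ℝ) ^ 2 = -1 := by exact_mod_cast h1
  nlinarith [sq_nonneg (InfinitePlace.embedding_of_isReal hw i : ℝ)]

/-! ## 2. The archimedean fibre and the identification `K_v ≃ ℂ` -/

/-- The archimedean place `w` underlying an element of the fibre of `V(F) → V_ℚ` over `∞`. [folklore] -/
def arcPlaceOf : (thetaIndex X).Fibre (.inl ()) → InfinitePlace F
  | ⟨.inl w, _⟩ => w
  | ⟨.inr _, h⟩ => absurd h (by simp [thetaIndex, Place.under])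

/-- **`φ_v : K_v ≃ ℂ`** as `ℚ`-modules, for `v | ∞`: Mathlib's `ringEquivComplexOfIsComplex` (the extension
`extensionEmbedding` of the embedding `w : F → ℂ` to the completion, bijective at a complex place), for the
carrier `log(𝒟^⊢_v) := K_v` of c312-5's `Real.logShellsDH` ([IUTchIII] Prop. 1.2 (vii)). [folklore] -/
def archφ (hc : ∀ w : InfinitePlace F, w.IsComplex) :
    ∀ x : (thetaIndex X).Fibre (.inl ()), (logShellsDH X logv).carrier x.1 ≃ₗ[ℚ] ℂ
  | ⟨.inl w, _⟩ =>
    { (InfinitePlace.Completion.ringEquivComplexOfIsComplex (hc w)).toAddEquiv with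
      map_smul' := fun c a =>
        map_rat_smul (InfinitePlace.Completion.ringEquivComplexOfIsComplex (hc w)) c a }
  | ⟨.inr _, h⟩ => absurd h (by simp [thetaIndex, Place.under])

/-- `φ_v` is `extensionEmbedding` as a function. [folklore] -/
theorem archφ_apply (hc : ∀ w : InfinitePlace F, w.IsComplex) (w : InfinitePlace F)
    (h : Place.under (.inl w : Place F) = .inl ()) (a : Carrier (.inl w : Place F)) :
    archφ X logv hc ⟨.inl w, h⟩ a = InfinitePlace.Completion.extensionEmbedding w a :=
  InfinitePlace.Completion.ringEquivComplexOfIsComplex_apply (hc w) a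

/-- `φ_v` is an isometry: `‖φ_v a‖ = ‖a‖` (Mathlib `isometry_extensionEmbedding`). [folklore] -/
theorem norm_archφ (hc : ∀ w : InfinitePlace F, w.IsComplex) (w : InfinitePlace F)
    (h : Place.under (.inl w : Place F) = .inl ()) (a : Carrier (.inl w : Place F)) :
    ‖archφ X logv hc ⟨.inl w, h⟩ a‖ = ‖a‖ := by
  rw [archφ_apply]
  exact (InfinitePlace.Completion.isometry_extensionEmbedding w).norm_map_of_map_zero (map_zero _) a

/-! ## 3. The archimedean presentation of `Real.logShellsDH` -/

/-- **The archimedean presentation of the real Dupuy–Hilado-level signature** `Real.logShellsDH X logv` over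
`v_ℚ = ∞`, under "`√−1 ∈ F`": `φ_v = extensionEmbedding`, shell = closed ball of radius `π` ([IUTchIII]
Rmk. 1.2.2 (ii)), strip-automorphisms trivial, the order-2 automorphisms `{1, −1}` acting by the isometries
`±1` of `ℂ`. [claim: Mochizuki2012, status: disputed] -/
def archPresentationDH (hc : ∀ w : InfinitePlace F, w.IsComplex) :
    ArchPresentation (logShellsDH X logv) (.inl ()) where
  φ := archφ X logv hc
  shell_eq := by
    rintro ⟨x1, h⟩
    rcases x1 with w | v
    · show archφ X logv hc ⟨.inl w, h⟩ '' shell logv (.inl w) = Metric.closedBall (0 : ℂ) Real.pi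
      rw [shell_inl]
      ext z
      simp only [Set.mem_image, Metric.mem_closedBall, dist_zero_right]
      constructor
      · rintro ⟨a, ha, rfl⟩
        rwa [norm_archφ]
      · intro hz
        obtain ⟨a, rfl⟩ := (archφ X logv hc ⟨.inl w, h⟩).surjective z
        exact ⟨a, by rwa [norm_archφ] at hz, rfl⟩
    · exact absurd h (by simp [thetaIndex, Place.under])
  strip_isometry := by
    rintro ⟨x1, h⟩ g hg
    have hg' : g = LinearEquiv.refl ℚ _ := hg
    subst hg'
    exact ⟨LinearIsometryEquiv.refl ℝ ℂ, fun _ => rfl⟩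
  ism_isometry := by
    rintro ⟨x1, h⟩ g hg
    rcases x1 with w | v
    · rcases hg with rfl | hg
      · exact ⟨LinearIsometryEquiv.refl ℝ ℂ, fun _ => rfl⟩
      · have hg' : g = LinearEquiv.neg ℚ := hg
        subst hg'
        exact ⟨LinearIsometryEquiv.neg ℝ, fun a => map_neg (archφ X logv hc ⟨.inl w, h⟩) a⟩
    · exact absurd h (by simp [thetaIndex, Place.under])

/-- **`GeneratorsPreserve` at the archimedean place for the real log-shells** (from
`ArchPresentation.generatorsPreserve_toLocalPieces`). [claim: Mochizuki2012, status: disputed] -/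
theorem generatorsPreserveDHArch (hc : ∀ w : InfinitePlace F, w.IsComplex) :
    (archPresentationDH X logv hc).toLocalPieces.GeneratorsPreserve :=
  (archPresentationDH X logv hc).generatorsPreserve_toLocalPieces

/-! ## 4. The container over all places with the honest archimedean term -/

variable {logv}

/-- **The local pieces of the real Dupuy–Hilado-level signature at every place, archimedean place HONEST**:
the real prime packets at `v_ℚ = p` (c312-5's `padicPresentationDH`), the real archimedean packets `M_I` at
`v_ℚ = ∞` (`archPresentationDH`). [claim: Mochizuki2012, status: disputed] -/
def localPiecesDHArch (hlog : LogvAnalytic logv) (hc : ∀ w : InfinitePlace F, w.IsComplex) :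
    ∀ vQ : (thetaIndex X).VQ, LocalPieces (logShellsDH X logv) vQ
  | .inl _ => (archPresentationDH X logv hc).toLocalPieces
  | .inr pp => haveI : Fact (pp : ℕ).Prime := ⟨pp.2⟩; (padicPresentationDH X pp.1 logv (hlog pp)).toLocalPieces

/-- **The verbatim container of the real log-shells over all places, archimedean place honest**
(`SummandPieces.ofLocal` of `localPiecesDHArch`). [claim: Mochizuki2012, status: disputed] -/
def summandPiecesDHArch (hlog : LogvAnalytic logv) (hc : ∀ w : InfinitePlace F, w.IsComplex) :
    SummandPieces (logShellsDH X logv) :=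
  SummandPieces.ofLocal (localPiecesDHArch X hlog hc)

/-- **The generator hypotheses HOLD for the real log-shells, at every place including `∞`.**
[claim: Mochizuki2012, status: disputed] -/
theorem generatorsPreserve_summandPiecesDHArch (hlog : LogvAnalytic logv)
    (hc : ∀ w : InfinitePlace F, w.IsComplex) : (summandPiecesDHArch X hlog hc).GeneratorsPreserve :=
  SummandPieces.generatorsPreserve_ofLocal _ fun vQ =>
    match vQ with
    | .inl _ => generatorsPreserveDHArch X logv hc
    | .inr pp => by haveI : Fact (pp : ℕ).Prime := ⟨pp.2⟩; exact generatorsPreserveDH X pp.1 logv (hlog pp)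

/-- The container for the ANALYTIC logarithm family under "`√−1 ∈ F`". [claim: Mochizuki2012, status: disputed] -/
def summandPiecesDHArchAnalytic (hc : ∀ w : InfinitePlace F, w.IsComplex) :
    SummandPieces (logShellsDH X (analyticLogv F)) :=
  summandPiecesDHArch X (logvAnalytic_analyticLogv (F := F)) hc

/-- … and its generator facts. [claim: Mochizuki2012, status: disputed] -/
theorem generatorsPreserve_summandPiecesDHArchAnalytic (hc : ∀ w : InfinitePlace F, w.IsComplex) :
    (summandPiecesDHArchAnalytic X hc).GeneratorsPreserve :=
  generatorsPreserve_summandPiecesDHArch X _ hc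

/-! ## 5. Consequences for the situation of Theorem 3.11 over the real log-shells -/

section Consequences

variable (hlog : LogvAnalytic logv) (hc : ∀ w : InfinitePlace F, w.IsComplex) (M : Type) [Field M] [NumberField M]
  (archPk : ∀ (j : (thetaIndex X).Label) (vQ : (thetaIndex X).VQ), Set ((logShellsDH X logv).Packet j vQ))
  (archSub : ∀ (j : (thetaIndex X).Label) (v : (thetaIndex X).V),
    Set ((logShellsDH X logv).Packet j ((thetaIndex X).over v)))
  (Ψ : ℤ → ∀ v : (thetaIndex X).V, v ∈ (thetaIndex X).Vbad → Set ((logShellsDH X logv).StarPacket v))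
  (act : ℤ → ∀ v : (thetaIndex X).V, v ∈ (thetaIndex X).Vbad →
    (logShellsDH X logv).StarPacket v → Module.End ℚ ((logShellsDH X logv).StarPacket v))
  (Mmod : ℤ → ∀ j : (thetaIndex X).LabelStar, Set ((logShellsDH X logv).GlobalPacket j.1))
  (region : ℤ → ∀ j : (thetaIndex X).LabelStar, FinDivisor M → ∀ vQ : (thetaIndex X).VQ,
    Set ((logShellsDH X logv).Packet j.1 vQ))

/-- The situation of Thm. 3.11 over the real Dupuy–Hilado-level log-shells WITH THE VERBATIM VOLUMES, archimedean
place honest (c312-5's `Situation.ofShells` with `Adm`/`logvol` := this container).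
[claim: Mochizuki2012, status: disputed] -/
abbrev situationDHVolArch : Situation (thetaIndex X) :=
  Situation.ofShells (logShellsDH X logv) M archPk archSub (summandPiecesDHArch X hlog hc).Adm
    (summandPiecesDHArch X hlog hc).logvol Ψ act Mmod region

/-- Every line of `situationDHVolArch` carries the container. [folklore] -/
theorem realizes_situationDHVolArch (n : ℤ) :
    (summandPiecesDHArch X hlog hc).Realizes
      ((situationDHVolArch X hlog hc M archPk archSub Ψ act Mmod region).D n) :=
  ⟨fun _ _ _ => Iff.rfl, fun _ _ _ => rfl⟩

/-- **(Ind1)/(Ind2) INVARIANCE ALONG THE WHOLE INDETERMINACY SUBGROUP for the real log-shells, archimedean place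
honest**: every `Φ ∈ ⟨Ind1Family ∪ Ind2Family⟩` carries every admissible region of every packet to an admissible
region OF THE SAME log-volume ([IUTchIII] proof of Cor. 3.12, Step (x), p. 181 l. 5–13) — B's named Prop
`MRData.LogvolInvariant` for this line data. [claim: Mochizuki2012, status: disputed] -/
theorem adm_and_logvol_eq_of_mem_indGroup_DHArch (n : ℤ) {Φ : (logShellsDH X logv).PacketAut}
    (hΦ : Φ ∈ Subgroup.closure ((logShellsDH X logv).Ind1Family ∪ (logShellsDH X logv).Ind2Family))
    (j : (thetaIndex X).Label) (vQ : (thetaIndex X).VQ) (A : Set ((logShellsDH X logv).Packet j vQ))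
    (hA : ((situationDHVolArch X hlog hc M archPk archSub Ψ act Mmod region).D n).Adm j vQ A) :
    ((situationDHVolArch X hlog hc M archPk archSub Ψ act Mmod region).D n).Adm j vQ (Φ j vQ '' A) ∧
      ((situationDHVolArch X hlog hc M archPk archSub Ψ act Mmod region).D n).logvol j vQ (Φ j vQ '' A) =
        ((situationDHVolArch X hlog hc M archPk archSub Ψ act Mmod region).D n).logvol j vQ A :=
  SummandPieces.adm_and_logvol_eq_of_mem_indGroup
    (realizes_situationDHVolArch X hlog hc M archPk archSub Ψ act Mmod region n)
    (generatorsPreserve_summandPiecesDHArch X hlog hc) hΦ j vQ A hA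

variable (P : Cor312.Setting (situationDHVolArch X hlog hc M archPk archSub Ψ act Mmod region))

/-- **Every possible image of the Θ-pilot object is admissible with the Θ-region's log-volume** (archimedean
place honest), as soon as the (Ind3)-enlarged Θ-region is admissible. [claim: Mochizuki2012, status: disputed] -/
theorem adm_and_logvol_possibleImage_eq_DHArch {j : (thetaIndex X).Label} {vQ : (thetaIndex X).VQ}
    (hθ : ((situationDHVolArch X hlog hc M archPk archSub Ψ act Mmod region).D P.n).Adm j vQ (P.thetaRegion3 j vQ))
    {U : Set ((logShellsDH X logv).Packet j vQ)} (hU : U ∈ P.possibleImages j vQ) :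
    ((situationDHVolArch X hlog hc M archPk archSub Ψ act Mmod region).D P.n).Adm j vQ U ∧
      ((situationDHVolArch X hlog hc M archPk archSub Ψ act Mmod region).D P.n).logvol j vQ U =
        ((situationDHVolArch X hlog hc M archPk archSub Ψ act Mmod region).D P.n).logvol j vQ
          (P.thetaRegion3 j vQ) :=
  SummandPieces.adm_and_logvol_possibleImage_eq
    (realizes_situationDHVolArch X hlog hc M archPk archSub Ψ act Mmod region P.n)
    (generatorsPreserve_summandPiecesDHArch X hlog hc) hθ hU

/-- **c312-6's `BridgeHyps` with `mono`, `image_adm`, `image_fin`, `theta_nonempty` DISCHARGED, archimedean place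
honest** — remaining named inputs exactly as in c312-5's `bridgeHyps_DH`: the (Ind3)-enlarged Θ-region is
admissible at every `(j, v_ℚ)`, `j ∈ 𝔽_l^⋇`, with finitely supported log-volume over `v_ℚ`, hull-sets are nonempty,
and `ThetaFinite`. [claim: Mochizuki2012, status: disputed] -/
theorem bridgeHyps_DHArch
    (hθ : ∀ (i : Fin (thetaIndex X).lstar) (vQ : (thetaIndex X).VQ),
      ((situationDHVolArch X hlog hc M archPk archSub Ψ act Mmod region).D P.n).Adm _ vQ
        (P.thetaRegion3 (Setting.labelSucc i) vQ))
    (hfin : ∀ i : Fin (thetaIndex X).lstar, (Function.support fun vQ : (thetaIndex X).VQ =>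
      ((situationDHVolArch X hlog hc M archPk archSub Ψ act Mmod region).D P.n).logvol _ vQ
        (P.thetaRegion3 (Setting.labelSucc i) vQ)).Finite)
    (hul_nonempty : ∀ (j : (thetaIndex X).Label) (vQ : (thetaIndex X).VQ), ∀ H ∈ (P.frame j vQ).Hul, H.Nonempty)
    (finite : P.ThetaFinite) : BridgeHyps P :=
  SummandPieces.bridgeHyps_of_summands
    (realizes_situationDHVolArch X hlog hc M archPk archSub Ψ act Mmod region P.n)
    (generatorsPreserve_summandPiecesDHArch X hlog hc) hθ hfin hul_nonempty finite

end Consequences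

/-! ## 6. The archimedean Θ-container of [IUTchIV] Step (vii) in this container -/

end Real

end Thm311

namespace Cor312Vol

namespace ArchPresentation

open Thm311 Literature.IUT.LogVolume.Prop15iii Literature.IUT.LogVolume.ArchPacket MeasureTheory
open scoped Pointwise

attribute [local instance] fibreFintype

variable {T : ThetaIndex} {L : LogShells T} {vQ : T.VQ} (P : ArchPresentation L vQ)

/-- **Scaled integral structures are admissible**: `r·B_I` (`r > 0`) has positive finite volume — its
coordinates are the polydisc of common radius `r` (L5-t7 `image_smul_eq`, `image_ball`, `smul_unitBall`).
In particular the Step (vii) container `π^{j+1}·B_I` ([IUTchIV] p. 30) is admissible. [claim: Mochizuki2012, status: disputed] -/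
theorem adm_smul_ball (j : T.Label) {r : ℝ} (hr : 0 < r) : adm vQ j (r • ball (Φ₀ vQ j)) := by
  have h : coords vQ j (r • ball (Φ₀ vQ j)) = polydisc (J vQ j) fun _ => r := by
    unfold coords
    rw [image_smul_eq, image_ball, smul_unitBall (J vQ j) hr.le]
  unfold adm
  rw [h]
  exact ⟨(volume_polydisc_pos (J vQ j) fun _ => hr).ne', (volume_polydisc_lt_top (J vQ j) _).ne⟩

/-- **Pull-backs of hull-sets are admissible**: for radii `r_idx > 0` the region `Φ₀⁻¹(Π_idx r_idx·𝒪_ℂ)` of `M_I`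
(a "hull-set `λ·𝒪_L` relative to the direct sum decomposition into copies of `ℂ`", [IUTchIII] Rmk. 3.9.5 (i)(ii)
p. 127) has positive finite volume — its coordinates ARE the polydisc (L5-t7 `volume_polydisc_pos`/`_lt_top`).
This is the `hadm`-input of c312-7's `Setting.ofComparison` at `v_ℚ = ∞` for frames built on `Φ₀`.
[claim: Mochizuki2012, status: disputed] -/
theorem adm_preimage_polydisc (j : T.Label) {r : J vQ j → ℝ} (hr : ∀ idx, 0 < r idx) :
    adm vQ j ((Φ₀ vQ j : X vQ j → (J vQ j → ℂ)) ⁻¹' polydisc (J vQ j) r) := by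
  have h : coords vQ j ((Φ₀ vQ j : X vQ j → (J vQ j → ℂ)) ⁻¹' polydisc (J vQ j) r) = polydisc (J vQ j) r := by
    unfold coords
    exact Set.image_preimage_eq _ (Φ₀ vQ j).surjective
  unfold adm
  rw [h]
  exact ⟨(volume_polydisc_pos (J vQ j) hr).ne', (volume_polydisc_lt_top (J vQ j) r).ne⟩

/-- … and their log-measure is the normalised log-volume of the polydisc, `(|J|)⁻¹·Σ_idx log r_idx`
(L5-t7 `nlogVol_polydisc`: the printed normalised-weight sum of radial log-volumes, [IUTchIII] Prop. 3.9 (i)).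
[claim: Mochizuki2012, status: disputed] -/
theorem logμ_preimage_polydisc (j : T.Label) {r : J vQ j → ℝ} (hr : ∀ idx, 0 < r idx) :
    logμ vQ j ((Φ₀ vQ j : X vQ j → (J vQ j → ℂ)) ⁻¹' polydisc (J vQ j) r) =
      (Fintype.card (J vQ j) : ℝ)⁻¹ * ∑ idx, Real.log (r idx) := by
  have h : coords vQ j ((Φ₀ vQ j : X vQ j → (J vQ j → ℂ)) ⁻¹' polydisc (J vQ j) r) = polydisc (J vQ j) r := by
    unfold coords
    exact Set.image_preimage_eq _ (Φ₀ vQ j).surjective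
  show nlogVol (J vQ j) (coords vQ j _) = _
  rw [h, nlogVol_polydisc (J vQ j) hr]

/-- The comparison pulls a region `S ⊆ M_I` back to a region of the `ℚ`-packet whose image is the one-factor
"direct product region" `Π_{Unit} S` (`e` is onto). [folklore] -/
theorem e_image_preimage (j : T.Label) (S : Set (X vQ j)) :
    P.toLocalPieces.e j '' (P.comparison j ⁻¹' S) = Set.pi univ fun _ : Unit => S := by
  ext y
  constructor
  · rintro ⟨x, hx, rfl⟩
    exact Set.mem_univ_pi.mpr fun _ => hx
  · intro hy
    have hy' : y () ∈ S := Set.mem_univ_pi.mp hy ()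
    obtain ⟨x, hx⟩ := P.comparison_surjective j (y ())
    refine ⟨x, ?_, funext fun u => ?_⟩
    · show P.comparison j x ∈ S
      rw [hx]
      exact hy'
    · cases u
      exact hx

/-- **Pull-backs of admissible regions of `M_I` are admissible regions of the packet** `𝓘^ℚ(^{S^±_{j+1}};𝒟^⊢_∞)`
for the archimedean local pieces. [claim: Mochizuki2012, status: disputed] -/
theorem adm_preimage_of_adm (j : T.Label) {S : Set (X vQ j)} (hS : adm vQ j S) :
    P.toLocalPieces.Adm j (P.comparison j ⁻¹' S) :=
  ⟨fun _ => S, P.e_image_preimage j S, fun _ => hS⟩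

end ArchPresentation

end Cor312Vol

namespace Thm311

namespace Real

open Cor312 Cor312Vol Literature.IUT.LogThetaLattice Literature.IUT.LogVolume Literature.IUT.LogVolume.Prop15iii
open scoped Pointwise

variable {F : Type} [Field F] [NumberField F] (X : PilotData F) {logv : PadicLogs F}
  (hlog : LogvAnalytic logv) (hc : ∀ w : InfinitePlace F, w.IsComplex)

/-- **The archimedean Θ-container of [IUTchIV] Thm. 1.10 Step (vii), pulled back to the `ℚ`-packet of the real
log-shells, IS ADMISSIBLE in the honest container** ("`π^{j+1}·B_I` serves as a container for the union of
possible images of a Θ-pilot object", p. 30): so the named residual `hθ` of `bridgeHyps_DHArch` is dischargeable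
AT `v_ℚ = ∞` for a Θ-box chosen as this container. [claim: Mochizuki2012, status: disputed] -/
theorem adm_thetaContainer_arch (j : (thetaIndex X).Label) :
    (summandPiecesDHArch X hlog hc).Adm j (.inl ())
      ((archPresentationDH X logv hc).comparison j ⁻¹'
        (Real.pi ^ Fintype.card ((thetaIndex X).Caps j) • ball (ArchPresentation.Φ₀ (T := thetaIndex X) (Sum.inl ()) j))) :=
  (archPresentationDH X logv hc).adm_preimage_of_adm j
    (ArchPresentation.adm_smul_ball j (pow_pos Real.pi_pos _))

/-- **… and its log-volume is EXACTLY `|S^±_{j+1}|·log π = (j+1)·log π`** — the archimedean term of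
[IUTchIV] Step (vii) p. 30 ("an upper bound `(j+1)·log(π)`"), which the trivial container of
`Cor312VolumesRealAssembly` recorded as `0`. [claim: Mochizuki2012, status: disputed] -/
theorem logvol_thetaContainer_arch (j : (thetaIndex X).Label) :
    (summandPiecesDHArch X hlog hc).logvol j (.inl ())
      ((archPresentationDH X logv hc).comparison j ⁻¹'
        (Real.pi ^ Fintype.card ((thetaIndex X).Caps j) • ball (ArchPresentation.Φ₀ (T := thetaIndex X) (Sum.inl ()) j))) =
      Fintype.card ((thetaIndex X).Caps j) * Real.log Real.pi := by
  rw [SummandPieces.logvol_eq_of_pi (R := fun _ : Unit => _)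
    ((archPresentationDH X logv hc).e_image_preimage j _)
    (fun _ => ArchPresentation.adm_smul_ball j (pow_pos Real.pi_pos _))]
  show ∑ _u : Unit, (1 : ℝ) * ArchPresentation.logμ (T := thetaIndex X) (Sum.inl ()) j _ = _
  rw [Fintype.sum_unique, one_mul]
  exact ArchPresentation.logμ_pi_pow_smul_ball j

end Real

end Thm311

end IUTFork

end Summit.ABC

end
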